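/-
Copyright (c) 2026. All rights reserved.
Released under Apache 2.0 license as described in the file LICENSE.
-/
import Mathlib.Analysis.Convex.Birkhoff

/-!
# MinimumPerfectMatchingFace — S2 of the succinct isolation series (O-L2-14)

The MINIMUM-WEIGHT PERFECT-MATCHING FACE in matrix form (Fenner–Gurjar–Thierauf 2016, Lemma 3.2 ∧
Lemma 3.3): for a bipartite graph `G` on `Fin r ⊔ Fin r` (perfect matchings = admissible permutations
`σ`, `G k (σ k)` for all `k`) and a weight `w`, every integer matrix `D` with ZERO ROW AND COLUMN SUMS
that is supported on entries used by minimum-weight perfect matchings is ORTHOGONAL to `w`: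
`Σ D_{ij} w_{ij} = 0`.  Applied to the signed incidence pattern `D` of a cycle in the union of the
minimum perfect matchings this is FGT16 Lemma 3.2 («every such cycle has circulation 0»), the engine
of one isolation round: a weight with non-zero circulation on a cycle `C` removes `C` from the union of
minimum perfect matchings.

Proof (the polytope argument of FGT16 §3, here via Mathlib's Birkhoff–von Neumann theorem
`exists_eq_sum_perm_of_mem_doublyStochastic`): let `x` be the barycentre of the permutation matrices
of one minimum admissible permutation through each non-zero entry of `D`; `x` is doubly stochastic,
has weight `m` (the minimum) and entries `≥ 1/N` on the support of `D`, so `x ± εD` is doubly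
stochastic for small `ε > 0`; by Birkhoff it is a convex combination of permutation matrices, each
of which (support argument) is an admissible permutation, hence of weight `≥ m`; so
`m ± ε·(w·D) ≥ m`, i.e. `w·D = 0`.

Currency: kernel-certified helper for the W4 isolation road (stage S2 of 4); closes no item; no
`def … : Prop`, no facts, no doors; one data def (`wt`, the weight functional).
-/

set_option linter.dupNamespace false

namespace Summit.ValiantsHypothesis.ValiantsHypothesis.Theorems.MinimumPerfectMatchingFace

variable {ι : Type*} [Fintype ι]

/-- The weight functional `w · M = Σ_{ij} M_{ij} w_{ij}` on rational matrices. [cite: FennerGurjarThierauf2016, Section 3] -/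
def wt (w : ι → ι → ℤ) (M : Matrix ι ι ℚ) : ℚ := ∑ i, ∑ j, M i j * (w i j : ℚ)

/-- `wt` is additive. [folklore] -/
theorem wt_add (w : ι → ι → ℤ) (M N : Matrix ι ι ℚ) : wt w (M + N) = wt w M + wt w N := by
  simp only [wt, Matrix.add_apply, add_mul, Finset.sum_add_distrib]

/-- `wt` is homogeneous. [folklore] -/
theorem wt_smul (w : ι → ι → ℤ) (c : ℚ) (M : Matrix ι ι ℚ) : wt w (c • M) = c * wt w M := by
  simp only [wt, Matrix.smul_apply, smul_eq_mul, mul_assoc, Finset.mul_sum]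

/-- `wt` of a weighted sum of matrices. [folklore] -/
theorem wt_sum (w : ι → ι → ℤ) {α : Type*} (s : Finset α) (c : α → ℚ) (M : α → Matrix ι ι ℚ) :
    wt w (∑ a ∈ s, c a • M a) = ∑ a ∈ s, c a * wt w (M a) := by
  classical
  induction s using Finset.induction_on with
  | empty => simp [wt]
  | insert a s ha ih => rw [Finset.sum_insert ha, Finset.sum_insert ha, wt_add, wt_smul, ih]

/-- Entries of a permutation matrix: `P_σ i j = [σ i = j]`. [folklore] -/
theorem permMatrix_apply' {κ : Type*} [DecidableEq κ] (σ : Equiv.Perm κ) (i j : κ) :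
    σ.permMatrix ℚ i j = if σ i = j then 1 else 0 := by
  simp [Equiv.Perm.permMatrix, PEquiv.toMatrix_apply, Equiv.toPEquiv_apply]

/-- The weight of a permutation matrix is the weight of the permutation. [folklore] -/
theorem wt_permMatrix [DecidableEq ι] (w : ι → ι → ℤ) (σ : Equiv.Perm ι) :
    wt w (σ.permMatrix ℚ) = ∑ k, (w k (σ k) : ℚ) := by
  simp only [wt, permMatrix_apply', ite_mul, one_mul, zero_mul, Finset.sum_ite_eq, Finset.mem_univ,
    ite_true]

set_option maxHeartbeats 800000 in
/-- **S2 MAIN (FGT16 Lemma 3.2 ∧ 3.3, matrix form): the minimum-weight face is orthogonal to every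
zero-line-sum matrix supported on it.**  If an integer matrix `D` has zero row and column sums and
every non-zero entry `(i, j)` of `D` is used by some MINIMUM-weight admissible permutation, then
`Σ D_{ij} w_{ij} = 0`. [cite: FennerGurjarThierauf2016, Lemma 3.3] -/
theorem face_orthogonal {r : ℕ} (G : Fin r → Fin r → Prop) (w : Fin r → Fin r → ℤ)
    (D : Matrix (Fin r) (Fin r) ℤ) (hrow : ∀ i, ∑ j, D i j = 0) (hcol : ∀ j, ∑ i, D i j = 0)
    (hD : ∀ i j, D i j ≠ 0 → ∃ σ : Equiv.Perm (Fin r), σ i = j ∧ (∀ k, G k (σ k)) ∧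
      ∀ τ : Equiv.Perm (Fin r), (∀ k, G k (τ k)) → ∑ k, w k (σ k) ≤ ∑ k, w k (τ k)) :
    ∑ i, ∑ j, D i j * w i j = 0 := by
  classical
  by_cases hD0 : ∀ i j, D i j = 0
  · simp [hD0]
  push Not at hD0
  obtain ⟨i₀, j₀, h₀⟩ := hD0
  obtain ⟨σ₀, -, hσ₀G, hσ₀min⟩ := hD i₀ j₀ h₀
  -- one minimum admissible permutation through every non-zero entry, all of the same weight `m`
  obtain ⟨m, hm⟩ : ∃ m : ℤ, m = ∑ k, w k (σ₀ k) := ⟨_, rfl⟩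
  have hch : ∀ e : Fin r × Fin r, ∃ σ : Equiv.Perm (Fin r),
      (D e.1 e.2 ≠ 0 → σ e.1 = e.2) ∧ (∀ k, G k (σ k)) ∧ ∑ k, w k (σ k) = m := by
    intro e
    by_cases he : D e.1 e.2 = 0
    · exact ⟨σ₀, fun h => (h he).elim, hσ₀G, hm.symm⟩
    · obtain ⟨σ, h1, h2, h3⟩ := hD e.1 e.2 he
      exact ⟨σ, fun _ => h1, h2, (le_antisymm (h3 σ₀ hσ₀G) (hσ₀min σ h2)).trans hm.symm⟩
  choose σ hσe hσG hσm using hch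
  have hmin : ∀ τ : Equiv.Perm (Fin r), (∀ k, G k (τ k)) → (m : ℚ) ≤ ∑ k, (w k (τ k) : ℚ) := by
    intro τ hτ
    have h := hσ₀min τ hτ
    rw [← hm] at h
    exact_mod_cast h
  have hσmQ : ∀ e, ∑ k, (w k (σ e k) : ℚ) = (m : ℚ) := fun e => by exact_mod_cast hσm e
  -- the support `E` of `D`, its size `N`, and the barycentre `x` of the chosen permutation matrices
  obtain ⟨E, hE⟩ : ∃ E : Finset (Fin r × Fin r), E = Finset.univ.filter fun e => D e.1 e.2 ≠ 0 :=
    ⟨_, rfl⟩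
  have hmemE : ∀ e, e ∈ E ↔ D e.1 e.2 ≠ 0 := fun e => by simp [hE]
  have hEne : E.Nonempty := ⟨(i₀, j₀), (hmemE (i₀, j₀)).2 h₀⟩
  obtain ⟨N, hN⟩ : ∃ N : ℚ, N = E.card := ⟨_, rfl⟩
  have hNpos : 0 < N := by rw [hN]; exact_mod_cast hEne.card_pos
  obtain ⟨x, hx⟩ : ∃ x : Matrix (Fin r) (Fin r) ℚ, x = ∑ e ∈ E, N⁻¹ • (σ e).permMatrix ℚ :=
    ⟨_, rfl⟩
  have hxmem : x ∈ doublyStochastic ℚ (Fin r) := by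
    rw [hx]
    refine convex_doublyStochastic.sum_mem (fun _ _ => inv_nonneg.2 hNpos.le) ?_
      fun e _ => permMatrix_mem_doublyStochastic
    rw [Finset.sum_const, nsmul_eq_mul, ← hN, mul_inv_cancel₀ hNpos.ne']
  obtain ⟨hx0, hxrow, hxcol⟩ := mem_doublyStochastic_iff_sum.1 hxmem
  have hxe : ∀ i j, x i j = ∑ e ∈ E, N⁻¹ * (if σ e i = j then 1 else 0) := by
    intro i j
    rw [hx, Matrix.sum_apply]
    simp only [Matrix.smul_apply, smul_eq_mul, permMatrix_apply']
  have hxlow : ∀ e ∈ E, N⁻¹ ≤ x e.1 e.2 := by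
    intro e he
    rw [hxe]
    refine le_trans (le_of_eq ?_) (Finset.single_le_sum (fun e' _ => ?_) he)
    · simp only [if_pos (hσe e ((hmemE e).1 he)), mul_one]
    · exact mul_nonneg (inv_nonneg.2 hNpos.le) (by split <;> norm_num)
  have hxwt : wt w x = m := by
    rw [hx, wt_sum]
    simp_rw [wt_permMatrix, hσmQ]
    rw [Finset.sum_const, nsmul_eq_mul, ← hN, ← mul_assoc, mul_inv_cancel₀ hNpos.ne', one_mul]
  -- the rational copy of `D`, its total mass `A`, and the step `ε = 1 / (N A)`
  obtain ⟨D', hD'def⟩ : ∃ D' : Matrix (Fin r) (Fin r) ℚ, D' = D.map (Int.cast : ℤ → ℚ) := ⟨_, rfl⟩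
  have hD' : ∀ i j, D' i j = (D i j : ℚ) := fun i j => by rw [hD'def, Matrix.map_apply]
  have hrow' : ∀ i, ∑ j, (D i j : ℚ) = 0 := fun i => by exact_mod_cast hrow i
  have hcol' : ∀ j, ∑ i, (D i j : ℚ) = 0 := fun j => by exact_mod_cast hcol j
  obtain ⟨A, hA⟩ : ∃ A : ℚ, A = ∑ e : Fin r × Fin r, |(D e.1 e.2 : ℚ)| := ⟨_, rfl⟩
  have hAe : ∀ i j, |(D i j : ℚ)| ≤ A := fun i j => by
    have h := Finset.single_le_sum (f := fun e : Fin r × Fin r => |(D e.1 e.2 : ℚ)|)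
      (fun e _ => abs_nonneg _) (Finset.mem_univ (i, j))
    rw [hA]
    exact h
  have hApos : 0 < A :=
    lt_of_lt_of_le (abs_pos.2 (by exact_mod_cast h₀ : (D i₀ j₀ : ℚ) ≠ 0)) (hAe i₀ j₀)
  obtain ⟨ε, hεdef⟩ : ∃ ε : ℚ, ε = N⁻¹ / A := ⟨_, rfl⟩
  have hε : 0 < ε := by rw [hεdef]; exact div_pos (inv_pos.2 hNpos) hApos
  have hεA : ε * A = N⁻¹ := by rw [hεdef]; exact div_mul_cancel₀ _ hApos.ne'
  -- KEY: `x + t D` is doubly stochastic for `|t| ≤ ε`, and (Birkhoff) has weight `≥ m`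
  have key : ∀ t : ℚ, |t| ≤ ε → (m : ℚ) ≤ wt w (x + t • D') := by
    intro t ht
    have hy : x + t • D' ∈ doublyStochastic ℚ (Fin r) := by
      rw [mem_doublyStochastic_iff_sum]
      refine ⟨fun i j => ?_, fun i => ?_, fun j => ?_⟩
      · simp only [Matrix.add_apply, Matrix.smul_apply, smul_eq_mul, hD']
        by_cases hij : D i j = 0
        · rw [hij, Int.cast_zero, mul_zero, add_zero]
          exact hx0 i j
        · have h1 : N⁻¹ ≤ x i j := hxlow (i, j) ((hmemE (i, j)).2 hij)
          have h2 : |t * (D i j : ℚ)| ≤ N⁻¹ := by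
            rw [abs_mul, ← hεA]
            exact mul_le_mul ht (hAe i j) (abs_nonneg _) hε.le
          have h3 := (abs_le.1 h2).1
          linarith
      · simp only [Matrix.add_apply, Matrix.smul_apply, smul_eq_mul, hD']
        rw [Finset.sum_add_distrib, ← Finset.mul_sum, hxrow i, hrow' i, mul_zero, add_zero]
      · simp only [Matrix.add_apply, Matrix.smul_apply, smul_eq_mul, hD']
        rw [Finset.sum_add_distrib, ← Finset.mul_sum, hxcol j, hcol' j, mul_zero, add_zero]
    obtain ⟨c, hc0, hc1, hcy⟩ := exists_eq_sum_perm_of_mem_doublyStochastic hy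
    -- every permutation in the Birkhoff decomposition is admissible (support argument)
    have hadm : ∀ τ : Equiv.Perm (Fin r), 0 < c τ → ∀ k, G k (τ k) := by
      intro τ hτ k
      have hle : (c τ • τ.permMatrix ℚ) k (τ k) ≤ ∑ s, (c s • s.permMatrix ℚ) k (τ k) :=
        Finset.single_le_sum (f := fun s : Equiv.Perm (Fin r) => (c s • s.permMatrix ℚ) k (τ k))
          (fun s _ => by
            simp only [Matrix.smul_apply, permMatrix_apply', smul_eq_mul]
            exact mul_nonneg (hc0 s) (by split <;> norm_num))
          (Finset.mem_univ τ)
      have hτpos : 0 < (c τ • τ.permMatrix ℚ) k (τ k) := by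
        simp only [Matrix.smul_apply, permMatrix_apply', smul_eq_mul, ite_true, mul_one]
        exact hτ
      have hpos : 0 < (x + t • D') k (τ k) := by
        rw [← hcy, Matrix.sum_apply]
        exact lt_of_lt_of_le hτpos hle
      by_cases hk : D k (τ k) = 0
      · have hxk : x k (τ k) ≠ 0 := by
          simp only [Matrix.add_apply, Matrix.smul_apply, smul_eq_mul, hD', hk, Int.cast_zero,
            mul_zero, add_zero] at hpos
          exact hpos.ne'
        rw [hxe] at hxk
        obtain ⟨e, -, he⟩ := Finset.exists_ne_zero_of_sum_ne_zero hxk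
        have hσk : σ e k = τ k := by
          by_contra hne
          exact he (by simp [hne])
        rw [← hσk]
        exact hσG e k
      · obtain ⟨σ', h1, h2, -⟩ := hD k (τ k) hk
        rw [← h1]
        exact h2 k
    -- weight of `x + t D` is at least `m`
    calc (m : ℚ) = ∑ τ, c τ * (m : ℚ) := by rw [← Finset.sum_mul, hc1, one_mul]
      _ ≤ ∑ τ, c τ * ∑ k, (w k (τ k) : ℚ) := Finset.sum_le_sum fun τ _ => by
          rcases (hc0 τ).eq_or_lt with h | h
          · rw [← h]
            simp
          · exact mul_le_mul_of_nonneg_left (hmin τ (hadm τ h)) h.le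
      _ = wt w (x + t • D') := by rw [← hcy, wt_sum]; simp_rw [wt_permMatrix]
  -- conclude: `m ≤ m ± ε (w·D)` forces `w·D = 0`
  have hplus := key ε (abs_of_pos hε).le
  have hminus := key (-ε) (by rw [abs_neg]; exact (abs_of_pos hε).le)
  rw [wt_add, wt_smul, hxwt] at hplus hminus
  have hwtD : wt w D' = ∑ i, ∑ j, (D i j : ℚ) * (w i j : ℚ) := by simp only [wt, hD']
  have h1 : 0 ≤ wt w D' := by nlinarith
  have h2 : wt w D' ≤ 0 := by nlinarith
  have h3 : wt w D' = 0 := le_antisymm h2 h1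
  rw [hwtD] at h3
  exact_mod_cast h3

end Summit.ValiantsHypothesis.ValiantsHypothesis.Theorems.MinimumPerfectMatchingFace
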